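import Literature.Topology.FourManifolds.LatticeFormsUnimodularTransvectionsPerfect
import Literature.Topology.FourManifolds.LatticeFormsNegTwoVectorOrbits
import HarnessLib

/-!
# `SO⁺(L₁ ⊕ U) ⊆ E_U(L₁)` as soon as `SO⁺(L₁) ⊆ E(L₁)`; hence `SO⁺(U ⊕ U ⊕ U) = E(3U)` is perfect
# (Gritsenko–Hulek–Sankaran, *J. Algebra* 322 (2009) Prop. 3.3 (iii), Lemma 3.2, Thm. 1.7 — the case `L = 3U`)

Trunk T-4MAN vocabulary. Sequel of `LatticeFormsOrthogonalGroupGeneration(Oriented).lean` (Prop. 3.3 (iii) with its `S̃O⁺`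
part: `φ = (ψ ⊕ 1)·A_a·w`), `LatticeFormsTwoHyperbolicPlanesSpecialOrthogonal.lean` (row g49-#4: `SO⁺(U ⊕ U₁)` consists of
admissible words), `LatticeFormsReflectionsUnimodularTransvections.lean` (g49-#1: Prop. 3.3 (ii)) and
`LatticeFormsUnimodularTransvectionsPerfect.lean` (g49-#6: `E_U(L₁)` is perfect when `L ⊇ 3U`); `TwoHyperbolicPairs.inl` is
reused from `LatticeFormsNegTwoVectorOrbits.lean`. Written for lane
`lit-hodgefound` (Track 2 foundations; prover seat `lit-hodgefound-p18`, gen 49, row g49-#7). THEOREMS ONLY — no definition,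
no named fact, no instance, no notation.

## Source, verbatim (held text `paper:arxiv-0810.1614`)

* §3.3 p. 7: "(iii) `O(L) = ⟨E_U(L₁), O(L₁)⟩`. […] Notice that (iii) is true for all the groups we have considered: for
  instance, `Õ⁺(L) = ⟨E_U(L₁), Õ⁺(L₁)⟩` and similarly for `SO`, `S̃O`, etc.."; §3.2 p. 6: "**Lemma 3.2.** `SO⁺(U ⊕ U₁)` is
  generated by the four transvections `t(e,e₁)`, `t(e,f₁)`, `t(f,e₁)` and `t(f,f₁)`."
* §1 p. 4: "**Theorem 1.7.** Let `L` be an even integral lattice containing at least two hyperbolic planes, such that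
  `rank₂(L) ≥ 6` and `rank₃(L) ≥ 5`. Then `S̃O⁺(L)^{ab}` is trivial and `Õ⁺(L)^{ab} ≅ ℤ/2ℤ`."; §4 p. 8: "It is enough to
  prove Theorem 1.7 for `S̃O⁺(L)` (or, equivalently by equation (16), for `E(L)`), because `Õ⁺(L) = ⟨S̃O⁺(L), σ_{e−f}⟩`."

## Contents (all proved) and reading notes

* §1 **`E(L₁) ⊕ 1 ⊆ E_U(L₁)`-words**: an admissible word of `Q` for a hyperbolic pair `x₁, y₁ ∈ Q`, extended by `1_H`, is an
  admissible word of `Q ⊕ H` for the outer pair (each letter `t(e₁,a) ⊕ 1 = t((e₁,0),(a,0))` is a unimodular transvection,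
  Prop. 3.3 (ii)) (`UGen.exists_uGens_prodCongr_refl_evalEquiv`).
* §2 **The inductive step "`SO⁺(L) = ⟨E_U(L₁), SO⁺(L₁)⟩`"**: if every element of `SO⁺(Q)` is an admissible word for
  `(x₁,y₁)`, then every element of `SO⁺(Q ⊕ H)` is an admissible word for the outer pair
  (`exists_uGens_eq_of_isOrientationPreserving_of_det_eq_one_prod`; `Q` symmetric even non-degenerate).
* §3 **`SO⁺(3U) = E(3U)`** from the base case `SO⁺(2U)` of Lemma 3.2 (g49-#4)
  (`exists_uGens_eq_of_isOrientationPreserving_of_det_eq_one_threeU`, and the equivalence `…_iff_exists_uGens_threeU`).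
* §4 **Theorem 1.7 for `L = 3U`, unconditionally**: every `φ ∈ SO⁺(U ⊕ U ⊕ U)` (`= S̃O⁺`, `3U` is unimodular) is a word in
  commutators of admissible words — "`S̃O⁺(L)^{ab}` is trivial" (`isWordIn_commutators_of_isOrientationPreserving_of_det_eq_one_threeU`,
  via g49-#6), and every `φ ∈ O⁺(3U)` is such a word or such a word times `σ = 1 ⊕ 1 ⊕ σ_H`
  ("`Õ⁺(L) = ⟨S̃O⁺(L), σ_{e−f}⟩`", `isWordIn_commutators_or_trans_swap_of_isOrientationPreserving_threeU`). For general
  `L = 2U ⊕ L₀` the equality `S̃O⁺(L) = E(L)` is Prop. 3.4 (Kneser), not in the tree.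
-/

noncomputable section

open Module
open LinearMap (BilinForm)
open LinearMap.BilinForm
open LinearMap.BilinForm (IsometryEquiv)
open Literature.LinearAlgebra.QuadraticForm

namespace Literature.Topology.FourManifolds

universe u

/-! ### §1 `E(L₁) ⊕ 1` consists of admissible words of `L₁ ⊕ U` -/

section Transfer

variable {V : Type u} [AddCommGroup V] {Q : BilinForm ℤ V} {x₁ y₁ : V}

/-- **`(τ ⊕ 1_H) ∈ E_U(L₁)` for `τ ∈ E_{U₁}(L₂)`**: an admissible word of `Q` for a hyperbolic pair `x₁, y₁` of `Q`,
extended by the identity of `H`, is an admissible word of `Q ⊕ H` for the outer pair `x, y` — letter by letter,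
`t(e₁,a) ⊕ 1 = t((e₁,0),(a,0))` is a unimodular transvection of `Q ⊕ H`, hence in `E_U(L₁)` by Prop. 3.3 (ii) (`Q` symmetric
even). [cite: GritsenkoHulekSankaran2009, Prop. 3.3 (ii)–(iii)] -/
theorem UGen.exists_uGens_prodCongr_refl_evalEquiv (hQ : Q.IsSymm) (hev : Q.IsEven) (hx₁ : Q x₁ x₁ = 0)
    (hy₁ : Q y₁ y₁ = 0) (hx₁y₁ : Q x₁ y₁ = 1) (l : List (UGen V)) (hl : ∀ g ∈ l, g.IsAdmissible Q x₁ y₁) :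
    ∃ L : List (UGen (V × (Fin 2 → ℤ))), (∀ g ∈ L, g.IsAdmissible (Q.prod hyperbolicForm) hypX hypY) ∧
      ∀ v, (LinearMap.BilinForm.IsometryEquiv.prodCongr (UGen.evalEquiv hQ hx₁ hy₁ l hl)
          (LinearMap.BilinForm.IsometryEquiv.refl hyperbolicForm) :
          (Q.prod hyperbolicForm).IsometryEquiv (Q.prod hyperbolicForm)) v =
        UGen.eval (Q.prod hyperbolicForm) hypX hypY L v := by
  have h2 := twoHyperbolicPairs_prod_hyperbolic hQ hx₁ hy₁ hx₁y₁
  have hev' : (Q.prod hyperbolicForm).IsEven := isEven_prod_hyperbolic hev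
  have hy₁x₁ : Q y₁ x₁ = 1 := by rw [hQ.eq, hx₁y₁]
  induction l with
  | nil => exact ⟨[], fun g hg ↦ (List.not_mem_nil hg).elim, fun v ↦ rfl⟩
  | cons g l ih =>
    obtain ⟨L, hL, hLv⟩ := ih fun g' hg' ↦ hl g' (List.mem_cons_of_mem g hg')
    have hg := hl g List.mem_cons_self
    -- the letter `g ⊕ 1` as a unimodular transvection of `Q ⊕ H`, then as an admissible word
    obtain ⟨Lg, hLg, hLgv⟩ : ∃ Lg : List (UGen (V × (Fin 2 → ℤ))),
        (∀ g' ∈ Lg, g'.IsAdmissible (Q.prod hyperbolicForm) hypX hypY) ∧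
        ∀ u, (LinearMap.BilinForm.IsometryEquiv.prodCongr (UGen.toIsometryEquiv hQ hx₁ hy₁ g hg)
            (LinearMap.BilinForm.IsometryEquiv.refl hyperbolicForm) :
            (Q.prod hyperbolicForm).IsometryEquiv (Q.prod hyperbolicForm)) u =
          UGen.eval (Q.prod hyperbolicForm) hypX hypY Lg u := by
      cases g with
      | atY a q =>
        obtain ⟨hxa, hya, haq⟩ := hg
        obtain ⟨Lg, hLg, hLgv⟩ := exists_uGens_eichlerTransvection_eq h2 hev' (u := (y₁, 0)) (z := (x₁, 0)) (a := (a, 0))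
          (q := q) (by rw [prod_hyperbolic_inl_inl, hy₁]) (by rw [prod_hyperbolic_inl_inl, hy₁x₁])
          (by rw [prod_hyperbolic_inl_inl, hya]) (by rw [prod_hyperbolic_inl_inl, haq])
        refine ⟨Lg, hLg, fun u ↦ ?_⟩
        rw [← hLgv, LinearMap.BilinForm.IsometryEquiv.prodCongr_apply, UGen.toIsometryEquiv_apply,
          LinearMap.BilinForm.IsometryEquiv.refl_apply, LinearMap.BilinForm.eichlerTransvection_prod_inl]
        rfl
      | atX a q =>
        obtain ⟨hxa, hya, haq⟩ := hg
        obtain ⟨Lg, hLg, hLgv⟩ := exists_uGens_eichlerTransvection_eq h2 hev' (u := (x₁, 0)) (z := (y₁, 0)) (a := (a, 0))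
          (q := q) (by rw [prod_hyperbolic_inl_inl, hx₁]) (by rw [prod_hyperbolic_inl_inl, hx₁y₁])
          (by rw [prod_hyperbolic_inl_inl, hxa]) (by rw [prod_hyperbolic_inl_inl, haq])
        refine ⟨Lg, hLg, fun u ↦ ?_⟩
        rw [← hLgv, LinearMap.BilinForm.IsometryEquiv.prodCongr_apply, UGen.toIsometryEquiv_apply,
          LinearMap.BilinForm.IsometryEquiv.refl_apply, LinearMap.BilinForm.eichlerTransvection_prod_inl]
        rfl
    refine ⟨Lg ++ L, fun g' hg' ↦ ?_, fun v ↦ ?_⟩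
    · rcases List.mem_append.1 hg' with hg' | hg'
      exacts [hLg g' hg', hL g' hg']
    · rw [UGen.eval_append, LinearMap.comp_apply, ← hLv, ← hLgv, LinearMap.BilinForm.IsometryEquiv.prodCongr_apply,
        LinearMap.BilinForm.IsometryEquiv.prodCongr_apply, LinearMap.BilinForm.IsometryEquiv.prodCongr_apply]
      rfl

end Transfer

/-! ### §2 The inductive step: `SO⁺(L₁ ⊕ U) ⊆ E_U(L₁)` once `SO⁺(L₁) ⊆ E(L₁)` -/

section Step

variable {V : Type u} [AddCommGroup V] [Module.Finite ℤ V] [Module.Free ℤ V] {Q : BilinForm ℤ V} {x₁ y₁ : V}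

/-- **"`SO⁺(L) = ⟨E_U(L₁), SO⁺(L₁)⟩`", inductively**: for `Q` symmetric even non-degenerate with a hyperbolic pair
`x₁, y₁`, if every isometry of `Q` in `O⁺` with determinant `1` is an admissible word for `(x₁, y₁)`, then every
isometry of `Q ⊕ H` in `O⁺` with determinant `1` is an admissible word for the outer pair: in `φ = (ψ ⊕ 1) · A_a · w`
(Prop. 3.3 (iii)) `A_a · w ∈ S̃O⁺` forces `ψ ∈ SO⁺(Q)`, so `ψ ⊕ 1 ∈ E_U(L₁)` by §1, and `A_a` is an admissible letter.
[cite: GritsenkoHulekSankaran2009, §3 (remark after Prop. 3.3: "similarly for SO")] -/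
theorem exists_uGens_eq_of_isOrientationPreserving_of_det_eq_one_prod (hQ : Q.IsSymm) (hev : Q.IsEven)
    (hndQ : Q.Nondegenerate) (hx₁ : Q x₁ x₁ = 0) (hy₁ : Q y₁ y₁ = 0) (hx₁y₁ : Q x₁ y₁ = 1)
    (IH : ∀ ψ : Q.IsometryEquiv Q, ψ.IsOrientationPreserving → LinearMap.det (ψ : V →ₗ[ℤ] V) = 1 →
      ∃ l : List (UGen V), (∀ g ∈ l, g.IsAdmissible Q x₁ y₁) ∧ ∀ v, ψ v = UGen.eval Q x₁ y₁ l v)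
    (φ : (Q.prod hyperbolicForm).IsometryEquiv (Q.prod hyperbolicForm)) (h₁ : φ.IsOrientationPreserving)
    (h₂ : LinearMap.det (φ : V × (Fin 2 → ℤ) →ₗ[ℤ] V × (Fin 2 → ℤ)) = 1) :
    ∃ L : List (UGen (V × (Fin 2 → ℤ))), (∀ g ∈ L, g.IsAdmissible (Q.prod hyperbolicForm) hypX hypY) ∧
      ∀ v, φ v = UGen.eval (Q.prod hyperbolicForm) hypX hypY L v := by
  have hB : (Q.prod hyperbolicForm).IsSymm := hQ.prod isSymm_hyperbolicForm
  have hnd : (Q.prod hyperbolicForm).Nondegenerate := hndQ.prod isUnimodular_hyperbolicForm_holds.nondegenerate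
  obtain ⟨l, hl, a, q, hq, ψ, hφ⟩ := exists_eq_prodCongr_trans_transvectionAEquiv_trans_evalEquiv hQ hev hx₁ hy₁ hx₁y₁ φ
  set ρ := (transvectionAEquiv hQ a q hq).trans (UGen.evalEquiv hB (prod_hyperbolic_hypX_hypX Q)
    (prod_hyperbolic_hypY_hypY Q) l hl) with hρ
  have hφ' : φ = (LinearMap.BilinForm.IsometryEquiv.prodCongr ψ
      (LinearMap.BilinForm.IsometryEquiv.refl hyperbolicForm)).trans ρ := by
    rw [hφ]
    rfl
  have hρS := mem_stableSpecialOrthogonal_trans hB hnd (transvectionAEquiv_mem_stableSpecialOrthogonal hQ hnd a q hq)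
    (UGen.evalEquiv_mem_stableSpecialOrthogonal hB hnd (prod_hyperbolic_hypX_hypX Q) (prod_hyperbolic_hypY_hypY Q) l hl)
  have hψ₁ : ψ.IsOrientationPreserving :=
    (isOrientationPreserving_iff_of_eq_prodCongr_refl_trans hQ hndQ hnd hφ' hρS.2.1).1 h₁
  have hψ₂ : LinearMap.det (ψ : V →ₗ[ℤ] V) = 1 := by
    rw [← det_eq_of_eq_prodCongr_refl_trans hφ' hρS.2.2]
    exact h₂
  obtain ⟨l', hl', hψ⟩ := IH ψ hψ₁ hψ₂
  have hψe : ψ = UGen.evalEquiv hQ hx₁ hy₁ l' hl' := DFunLike.ext _ _ fun v ↦ by rw [hψ, UGen.evalEquiv_apply]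
  obtain ⟨L', hL', hL'v⟩ := UGen.exists_uGens_prodCongr_refl_evalEquiv hQ hev hx₁ hy₁ hx₁y₁ l' hl'
  refine ⟨l ++ (UGen.atY ((a, 0)) q :: L'), fun g hg ↦ ?_, fun v ↦ ?_⟩
  · rcases List.mem_append.1 hg with hg | hg
    · exact hl g hg
    · rcases List.mem_cons.1 hg with rfl | hg
      · exact ⟨prod_hyperbolic_hypX_inl Q a, prod_hyperbolic_hypY_inl Q a, by rw [prod_hyperbolic_inl_inl, hq]⟩
      · exact hL' g hg
  · rw [hφ', hψe, UGen.eval_append, LinearMap.comp_apply, UGen.eval_cons, LinearMap.comp_apply, ← hL'v,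
      LinearMap.BilinForm.IsometryEquiv.trans_apply, hρ, LinearMap.BilinForm.IsometryEquiv.trans_apply,
      UGen.evalEquiv_apply, transvectionAEquiv_apply]
    rfl

end Step

/-! ### §3 `SO⁺(U ⊕ U ⊕ U) = E(3U)` -/

section ThreeU

/-- `(H ⊕ H) ⊕ H` is even. [cite: GritsenkoHulekSankaran2009, §1 ("integral even lattice")] -/
theorem isEven_threeU : ((hyperbolicForm.prod hyperbolicForm).prod hyperbolicForm).IsEven :=
  isEven_prod_hyperbolic (isEven_prod_hyperbolic isEven_hyperbolicForm)

/-- `(H ⊕ H) ⊕ H` is non-degenerate. [cite: GritsenkoHulekSankaran2009, §1] -/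
theorem nondegenerate_threeU : ((hyperbolicForm.prod hyperbolicForm).prod hyperbolicForm).Nondegenerate :=
  nondegenerate_hyperbolicForm_prod_hyperbolicForm.prod isUnimodular_hyperbolicForm_holds.nondegenerate

/-- **`SO⁺(U ⊕ U ⊕ U) ⊆ E_U`**: every isometry of `(H ⊕ H) ⊕ H` in `O⁺` with determinant `1` is an admissible word in the
transvections at the outer hyperbolic pair (§2 on top of Lemma 3.2, `SO⁺(U ⊕ U₁) = E_U(U₁)`).
[cite: GritsenkoHulekSankaran2009, §3.2 Lemma 3.2 and §3 (remark after Prop. 3.3)] -/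
theorem exists_uGens_eq_of_isOrientationPreserving_of_det_eq_one_threeU
    (φ : ((hyperbolicForm.prod hyperbolicForm).prod hyperbolicForm).IsometryEquiv
      ((hyperbolicForm.prod hyperbolicForm).prod hyperbolicForm))
    (h₁ : φ.IsOrientationPreserving)
    (h₂ : LinearMap.det (φ : ((Fin 2 → ℤ) × (Fin 2 → ℤ)) × (Fin 2 → ℤ) →ₗ[ℤ]
      ((Fin 2 → ℤ) × (Fin 2 → ℤ)) × (Fin 2 → ℤ)) = 1) :
    ∃ L : List (UGen (((Fin 2 → ℤ) × (Fin 2 → ℤ)) × (Fin 2 → ℤ))),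
      (∀ g ∈ L, g.IsAdmissible ((hyperbolicForm.prod hyperbolicForm).prod hyperbolicForm) hypX hypY) ∧
      ∀ v, φ v = UGen.eval ((hyperbolicForm.prod hyperbolicForm).prod hyperbolicForm) hypX hypY L v :=
  exists_uGens_eq_of_isOrientationPreserving_of_det_eq_one_prod (isSymm_hyperbolicForm.prod isSymm_hyperbolicForm)
    (isEven_prod_hyperbolic isEven_hyperbolicForm) nondegenerate_hyperbolicForm_prod_hyperbolicForm
    (prod_hyperbolic_hypX_hypX hyperbolicForm) (prod_hyperbolic_hypY_hypY hyperbolicForm)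
    (prod_hyperbolic_hypX_hypY hyperbolicForm)
    (fun ψ hψ₁ hψ₂ ↦ exists_uGens_eq_of_isOrientationPreserving_of_det_eq_one ψ hψ₁ hψ₂) φ h₁ h₂

/-- **`SO⁺(U ⊕ U ⊕ U) = E(3U)`**: `φ ∈ O⁺` with `det φ = 1` iff `φ` is an admissible word (admissible words lie in `S̃O⁺`).
[cite: GritsenkoHulekSankaran2009, §3.2 Lemma 3.2, §3.1 (8) and §3 (remark after Prop. 3.3)] -/
theorem isOrientationPreserving_and_det_eq_one_iff_exists_uGens_threeU
    (φ : ((hyperbolicForm.prod hyperbolicForm).prod hyperbolicForm).IsometryEquiv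
      ((hyperbolicForm.prod hyperbolicForm).prod hyperbolicForm)) :
    (φ.IsOrientationPreserving ∧ LinearMap.det (φ : ((Fin 2 → ℤ) × (Fin 2 → ℤ)) × (Fin 2 → ℤ) →ₗ[ℤ]
        ((Fin 2 → ℤ) × (Fin 2 → ℤ)) × (Fin 2 → ℤ)) = 1) ↔
      ∃ (L : List (UGen (((Fin 2 → ℤ) × (Fin 2 → ℤ)) × (Fin 2 → ℤ))))
        (hL : ∀ g ∈ L, g.IsAdmissible ((hyperbolicForm.prod hyperbolicForm).prod hyperbolicForm) hypX hypY),
        φ = UGen.evalEquiv ((isSymm_hyperbolicForm.prod isSymm_hyperbolicForm).prod isSymm_hyperbolicForm)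
          prod_prod_hyperbolic_hypX_hypX prod_prod_hyperbolic_hypY_hypY L hL := by
  constructor
  · rintro ⟨h₁, h₂⟩
    obtain ⟨L, hL, hφ⟩ := exists_uGens_eq_of_isOrientationPreserving_of_det_eq_one_threeU φ h₁ h₂
    exact ⟨L, hL, DFunLike.ext _ _ fun v ↦ by rw [hφ, UGen.evalEquiv_apply]⟩
  · rintro ⟨L, hL, rfl⟩
    exact (UGen.evalEquiv_mem_stableSpecialOrthogonal
      ((isSymm_hyperbolicForm.prod isSymm_hyperbolicForm).prod isSymm_hyperbolicForm) nondegenerate_threeU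
      prod_prod_hyperbolic_hypX_hypX prod_prod_hyperbolic_hypY_hypY L hL).2

end ThreeU

/-! ### §4 Theorem 1.7 for `L = 3U`: `SO⁺(U ⊕ U ⊕ U)` is perfect -/

section Perfect

variable {V₁ V₂ : Type*} [AddCommGroup V₁] [AddCommGroup V₂] {B₁ : BilinForm ℤ V₁} {B₂ : BilinForm ℤ V₂}

/-- The outer and the innermost hyperbolic pairs of `(H ⊕ H) ⊕ H`. [cite: GritsenkoHulekSankaran2009, §3.2] -/
theorem twoHyperbolicPairs_threeU_outer_inner :
    TwoHyperbolicPairs ((hyperbolicForm.prod hyperbolicForm).prod hyperbolicForm) hypX hypY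
      ((((Pi.single 0 1 : Fin 2 → ℤ), (0 : Fin 2 → ℤ)) : (Fin 2 → ℤ) × (Fin 2 → ℤ)), (0 : Fin 2 → ℤ))
      ((((Pi.single 1 1 : Fin 2 → ℤ), (0 : Fin 2 → ℤ)) : (Fin 2 → ℤ) × (Fin 2 → ℤ)), (0 : Fin 2 → ℤ)) :=
  twoHyperbolicPairs_prod_hyperbolic (isSymm_hyperbolicForm.prod isSymm_hyperbolicForm)
    (by rw [prod_hyperbolic_inl_inl, hyperbolicPlane_apply_e₀_e₀, add_zero])
    (by rw [prod_hyperbolic_inl_inl, hyperbolicPlane_apply_e₁_e₁, add_zero])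
    (by rw [prod_hyperbolic_inl_inl, hyperbolicForm_apply]; simp)

/-- The middle and the innermost hyperbolic pairs of `(H ⊕ H) ⊕ H`. [cite: GritsenkoHulekSankaran2009, §3.2] -/
theorem twoHyperbolicPairs_threeU_middle_inner :
    TwoHyperbolicPairs ((hyperbolicForm.prod hyperbolicForm).prod hyperbolicForm)
      (((hypX : (Fin 2 → ℤ) × (Fin 2 → ℤ))), (0 : Fin 2 → ℤ)) (((hypY : (Fin 2 → ℤ) × (Fin 2 → ℤ))), (0 : Fin 2 → ℤ))
      ((((Pi.single 0 1 : Fin 2 → ℤ), (0 : Fin 2 → ℤ)) : (Fin 2 → ℤ) × (Fin 2 → ℤ)), (0 : Fin 2 → ℤ))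
      ((((Pi.single 1 1 : Fin 2 → ℤ), (0 : Fin 2 → ℤ)) : (Fin 2 → ℤ) × (Fin 2 → ℤ)), (0 : Fin 2 → ℤ)) :=
  (twoHyperbolicPairs_prod_hyperbolic isSymm_hyperbolicForm (Eq.trans hyperbolicPlane_apply_e₀_e₀ (add_zero 0))
    (Eq.trans hyperbolicPlane_apply_e₁_e₁ (add_zero 0)) (by rw [hyperbolicForm_apply]; simp)).inl isSymm_hyperbolicForm

/-- **Theorem 1.7 for `L = U ⊕ U ⊕ U`: `SO⁺(3U)^{ab}` is trivial** — every isometry of `(H ⊕ H) ⊕ H` in `O⁺` with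
determinant `1` is a word in the commutators `[α,β] = αβα⁻¹β⁻¹` of admissible words (stated for any set `C` containing
them): `SO⁺(3U) = E(3U)` (§3) and `E(3U)` is perfect (row g49-#6). No Kneser theorem and no strong approximation are
needed for this lattice. [cite: GritsenkoHulekSankaran2009, Thm. 1.7 and §4.1] -/
theorem isWordIn_commutators_of_isOrientationPreserving_of_det_eq_one_threeU
    {C : Set (((hyperbolicForm.prod hyperbolicForm).prod hyperbolicForm).IsometryEquiv
      ((hyperbolicForm.prod hyperbolicForm).prod hyperbolicForm))}
    (hC : ∀ (l₁ l₂ : List (UGen (((Fin 2 → ℤ) × (Fin 2 → ℤ)) × (Fin 2 → ℤ))))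
      (hl₁ : ∀ g ∈ l₁, g.IsAdmissible ((hyperbolicForm.prod hyperbolicForm).prod hyperbolicForm) hypX hypY)
      (hl₂ : ∀ g ∈ l₂, g.IsAdmissible ((hyperbolicForm.prod hyperbolicForm).prod hyperbolicForm) hypX hypY),
      (((UGen.evalEquiv ((isSymm_hyperbolicForm.prod isSymm_hyperbolicForm).prod isSymm_hyperbolicForm)
            prod_prod_hyperbolic_hypX_hypX prod_prod_hyperbolic_hypY_hypY l₂ hl₂).symm.trans
          (UGen.evalEquiv ((isSymm_hyperbolicForm.prod isSymm_hyperbolicForm).prod isSymm_hyperbolicForm)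
            prod_prod_hyperbolic_hypX_hypX prod_prod_hyperbolic_hypY_hypY l₁ hl₁).symm).trans
          (UGen.evalEquiv ((isSymm_hyperbolicForm.prod isSymm_hyperbolicForm).prod isSymm_hyperbolicForm)
            prod_prod_hyperbolic_hypX_hypX prod_prod_hyperbolic_hypY_hypY l₂ hl₂)).trans
        (UGen.evalEquiv ((isSymm_hyperbolicForm.prod isSymm_hyperbolicForm).prod isSymm_hyperbolicForm)
            prod_prod_hyperbolic_hypX_hypX prod_prod_hyperbolic_hypY_hypY l₁ hl₁) ∈ C)
    (φ : ((hyperbolicForm.prod hyperbolicForm).prod hyperbolicForm).IsometryEquiv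
      ((hyperbolicForm.prod hyperbolicForm).prod hyperbolicForm))
    (h₁ : φ.IsOrientationPreserving)
    (h₂ : LinearMap.det (φ : ((Fin 2 → ℤ) × (Fin 2 → ℤ)) × (Fin 2 → ℤ) →ₗ[ℤ]
      ((Fin 2 → ℤ) × (Fin 2 → ℤ)) × (Fin 2 → ℤ)) = 1) :
    IsWordIn C φ := by
  obtain ⟨L, hL, rfl⟩ := (isOrientationPreserving_and_det_eq_one_iff_exists_uGens_threeU φ).1 ⟨h₁, h₂⟩
  exact isWordIn_commutators_evalEquiv (twoHyperbolicPairs_prod_prod_hyperbolic isSymm_hyperbolicForm)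
    twoHyperbolicPairs_threeU_outer_inner twoHyperbolicPairs_threeU_middle_inner isEven_threeU hC L hL

/-- `det (1 ⊕ g) = det g` on `Λ₁ ⊕ Λ₂`. [cite: GritsenkoHulekSankaran2009, §4 ("Õ⁺(L) = ⟨S̃O⁺(L), σ_{e−f}⟩")] -/
theorem IsometryEquiv.det_refl_prodCongr [Module.Finite ℤ V₁] [Module.Free ℤ V₁] [Module.Finite ℤ V₂] [Module.Free ℤ V₂]
    (g : B₂.IsometryEquiv B₂) :
    LinearMap.det ((LinearMap.BilinForm.IsometryEquiv.prodCongr (LinearMap.BilinForm.IsometryEquiv.refl B₁) g :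
        (B₁.prod B₂).IsometryEquiv (B₁.prod B₂)) : V₁ × V₂ →ₗ[ℤ] V₁ × V₂) = LinearMap.det (g : V₂ →ₗ[ℤ] V₂) := by
  rw [show ((LinearMap.BilinForm.IsometryEquiv.prodCongr (LinearMap.BilinForm.IsometryEquiv.refl B₁) g :
        (B₁.prod B₂).IsometryEquiv (B₁.prod B₂)) : V₁ × V₂ →ₗ[ℤ] V₁ × V₂) = LinearMap.id.prodMap (g : V₂ →ₗ[ℤ] V₂) from
      LinearMap.ext fun _ ↦ rfl, LinearMap.det_prodMap, LinearMap.det_id, one_mul]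

/-- **"`Õ⁺(L) = ⟨S̃O⁺(L), σ_{e−f}⟩`" for `L = 3U`**: every isometry of `(H ⊕ H) ⊕ H` in `O⁺` is a word in commutators of
admissible words, or such a word followed by the swap `σ = 1 ⊕ 1 ⊕ σ_H` of the outer plane (which lies in `O⁺` with
determinant `−1`) — so `O⁺(3U)^{ab}` has order at most `2`. [cite: GritsenkoHulekSankaran2009, Thm. 1.7 and §4] -/
theorem isWordIn_commutators_or_trans_swap_of_isOrientationPreserving_threeU
    {C : Set (((hyperbolicForm.prod hyperbolicForm).prod hyperbolicForm).IsometryEquiv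
      ((hyperbolicForm.prod hyperbolicForm).prod hyperbolicForm))}
    (hC : ∀ (l₁ l₂ : List (UGen (((Fin 2 → ℤ) × (Fin 2 → ℤ)) × (Fin 2 → ℤ))))
      (hl₁ : ∀ g ∈ l₁, g.IsAdmissible ((hyperbolicForm.prod hyperbolicForm).prod hyperbolicForm) hypX hypY)
      (hl₂ : ∀ g ∈ l₂, g.IsAdmissible ((hyperbolicForm.prod hyperbolicForm).prod hyperbolicForm) hypX hypY),
      (((UGen.evalEquiv ((isSymm_hyperbolicForm.prod isSymm_hyperbolicForm).prod isSymm_hyperbolicForm)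
            prod_prod_hyperbolic_hypX_hypX prod_prod_hyperbolic_hypY_hypY l₂ hl₂).symm.trans
          (UGen.evalEquiv ((isSymm_hyperbolicForm.prod isSymm_hyperbolicForm).prod isSymm_hyperbolicForm)
            prod_prod_hyperbolic_hypX_hypX prod_prod_hyperbolic_hypY_hypY l₁ hl₁).symm).trans
          (UGen.evalEquiv ((isSymm_hyperbolicForm.prod isSymm_hyperbolicForm).prod isSymm_hyperbolicForm)
            prod_prod_hyperbolic_hypX_hypX prod_prod_hyperbolic_hypY_hypY l₂ hl₂)).trans
        (UGen.evalEquiv ((isSymm_hyperbolicForm.prod isSymm_hyperbolicForm).prod isSymm_hyperbolicForm)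
            prod_prod_hyperbolic_hypX_hypX prod_prod_hyperbolic_hypY_hypY l₁ hl₁) ∈ C)
    (φ : ((hyperbolicForm.prod hyperbolicForm).prod hyperbolicForm).IsometryEquiv
      ((hyperbolicForm.prod hyperbolicForm).prod hyperbolicForm))
    (h₁ : φ.IsOrientationPreserving) :
    IsWordIn C φ ∨ IsWordIn C (φ.trans (LinearMap.BilinForm.IsometryEquiv.prodCongr
      (LinearMap.BilinForm.IsometryEquiv.refl (hyperbolicForm.prod hyperbolicForm)) hyperbolicSwap)) := by
  have hQ : (hyperbolicForm.prod hyperbolicForm).IsSymm := isSymm_hyperbolicForm.prod isSymm_hyperbolicForm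
  have hB : ((hyperbolicForm.prod hyperbolicForm).prod hyperbolicForm).IsSymm := hQ.prod isSymm_hyperbolicForm
  rcases LinearMap.BilinForm.IsometryEquiv.det_eq_one_or_eq_neg_one φ with hdet | hdet
  · exact Or.inl (isWordIn_commutators_of_isOrientationPreserving_of_det_eq_one_threeU hC φ h₁ hdet)
  · refine Or.inr (isWordIn_commutators_of_isOrientationPreserving_of_det_eq_one_threeU hC _ ?_ ?_)
    · rw [LinearMap.BilinForm.IsometryEquiv.isOrientationPreserving_trans_iff hB nondegenerate_threeU,
        LinearMap.BilinForm.IsometryEquiv.isOrientationPreserving_refl_prodCongr_iff hQ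
          nondegenerate_hyperbolicForm_prod_hyperbolicForm isSymm_hyperbolicForm
          isUnimodular_hyperbolicForm_holds.nondegenerate]
      exact iff_of_true isOrientationPreserving_hyperbolicSwap h₁
    · rw [show ((φ.trans (LinearMap.BilinForm.IsometryEquiv.prodCongr
            (LinearMap.BilinForm.IsometryEquiv.refl (hyperbolicForm.prod hyperbolicForm)) hyperbolicSwap) :
            ((hyperbolicForm.prod hyperbolicForm).prod hyperbolicForm).IsometryEquiv _) :
            ((Fin 2 → ℤ) × (Fin 2 → ℤ)) × (Fin 2 → ℤ) →ₗ[ℤ] ((Fin 2 → ℤ) × (Fin 2 → ℤ)) × (Fin 2 → ℤ)) =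
          ((LinearMap.BilinForm.IsometryEquiv.prodCongr
            (LinearMap.BilinForm.IsometryEquiv.refl (hyperbolicForm.prod hyperbolicForm)) hyperbolicSwap :
            ((hyperbolicForm.prod hyperbolicForm).prod hyperbolicForm).IsometryEquiv _) :
            ((Fin 2 → ℤ) × (Fin 2 → ℤ)) × (Fin 2 → ℤ) →ₗ[ℤ] ((Fin 2 → ℤ) × (Fin 2 → ℤ)) × (Fin 2 → ℤ)) ∘ₗ
          (φ : ((Fin 2 → ℤ) × (Fin 2 → ℤ)) × (Fin 2 → ℤ) →ₗ[ℤ] ((Fin 2 → ℤ) × (Fin 2 → ℤ)) × (Fin 2 → ℤ)) from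
        LinearMap.ext fun _ ↦ rfl, LinearMap.det_comp, IsometryEquiv.det_refl_prodCongr, det_hyperbolicSwap, hdet]
      norm_num

end Perfect

end Literature.Topology.FourManifolds

end
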